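import Literature.Analysis.Calculus.SmoothCutoff
import Literature.Barriers.NavierStokesRegularity.NavierStokesInequalityOscillation
import HarnessLib

/-!
# Oscillatory processes for Scheffer's NSI block, II: smoothing the square waves (Ożański 2017, §4.3)

Second support file for Ożański's Theorem 10 (arXiv:1709.00602, §4.3; sequential numbering of the
held text, = Theorem 4.3 in the section-wise numbering of arXiv v4), on the discharge path of
`NSIBlock_of_arrangement` (fact D of `NavierStokesInequalityArrangement`, Ożański 2017, §4). The
oscillatory processes `a₁ᵏ, a₂ᵏ ∈ C^∞(ℝ; [-1,1])` are obtained from the square waves `b₁ᵏ, b₂ᵏ`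
((4.28), `Scheffer.wave`) by smoothing: "let
`a₁ᵏ, a₂ᵏ ∈ C^∞(ℝ; [-1,1])` be such that `|{t ∈ [0,T] : aᵢᵏ(t) ≠ bᵢᵏ(t)}| ≤ 1/k` … Such
`a₁ᵏ, a₂ᵏ` can be obtained by extending `b₁ᵏ, b₂ᵏ` to the whole line by zero and mollifying"
(p. 19), after which "the difference between the left-hand sides of (4.22) and (4.31) is bounded
by `6N/k → 0`". Instead of a mollifier we use an explicit and equivalent smoothing by the tree's
plateau cut-offs (`Literature.Analysis.Calculus.cutoff`): on each quarter `[jh, (j+1)h]` the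
process equals the quarter value times a smooth plateau function which is `1` except on two
margins of width `w = h/(2R)` and vanishes outside the open quarter. This file provides

* `bump h R j`, `process c h R n = Σ_{j<n} c_{j mod 4} · bump h R j`: the smooth processes;
  `contDiff_process`, `abs_process_le_one` (values in `[-1,1]`), `process_eq` (the process
  equals `c_{j mod 4}` on the plateau `[jh + w, (j+1)h - w]`);
* `abs_integral_le_of_eqOn_plateau_zero`: if an integrable `f` with `|f| ≤ B` on `[0, nh]`
  vanishes on every plateau, then `|∫₀ᵗ f| ≤ n · 2wB` for `t ∈ [0, nh]` — the "`6N/k`" bound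
  (with `n · 2w = nh/R = T/R`);
* `abs_integral_sub_sum_le`: the approximation lemma combining the two — if `A` agrees on the
  plateaus with a finite sum `Σ_r wave c_r · φ_r` of square waves times continuous functions,
  then `|∫₀ᵗ A - Σ_r mean(c_r) ∫₀ᵗ φ_r| ≤ (B + mN)T/(k+1) + m(2εT + 2N T/k)` (the structure of
  Ożański's proof of Thm. 10, pp. 18–19).

## References

* W. S. Ożański, arXiv:1709.00602 (2017), §4.3, proof of Theorem 10 (p. 19).
  [`Ozanski2017NSIInternal`]
-/

noncomputable section

open Set MeasureTheory intervalIntegral Function Literature.Analysis.Calculus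
open scoped Interval ContDiff

namespace Literature.Barriers.NavierStokesRegularity

namespace Scheffer

/-! ### Smooth plateau processes -/

/-- The smooth plateau function of the `j`-th quarter `[jh, (j+1)h]` with sharpness `R ≥ 1`:
`bump h R j s = cutoff R ((s - (j + 1/2)h) · 2R/h)`, equal to `1` for
`|s - (j+1/2)h| ≤ h/2 - h/(2R)`, to `0` for `|s - (j+1/2)h| ≥ h/2`, smooth, with values in
`[0,1]` (an explicit substitute for the mollification on p. 19 of Ożański 2017). [folklore] -/
def bump (h R : ℝ) (j : ℕ) (s : ℝ) : ℝ :=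
  cutoff R ((s - ((j : ℝ) + 1 / 2) * h) * (2 * R / h))

/-- **The smoothed square wave** (oscillatory process) with quarter values `c`, quarter length
`h`, sharpness `R` and `n` quarters: `process c h R n = Σ_{j<n} c_{j mod 4} · bump h R j`
(Ożański 2017, p. 19: `aᵢᵏ`, a smoothing of `bᵢᵏ` that differs from it on a set of small
measure). [cite: Ozanski2017NSIInternal, §4.3 p. 19] -/
def process (c : Fin 4 → ℝ) (h R : ℝ) (n : ℕ) (s : ℝ) : ℝ :=
  ∑ j ∈ Finset.range n, c ⟨j % 4, Nat.mod_lt _ (by norm_num)⟩ * bump h R j s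

/-- The plateau functions are smooth. [folklore] -/
theorem contDiff_bump (h R : ℝ) (j : ℕ) : ContDiff ℝ ∞ (bump h R j) := by
  unfold bump
  exact (contDiff_cutoff R).comp ((contDiff_id.sub contDiff_const).mul contDiff_const)

/-- **The processes are smooth** (`aᵢᵏ ∈ C^∞(ℝ)`). [cite: Ozanski2017NSIInternal, Thm. 10] -/
theorem contDiff_process (c : Fin 4 → ℝ) (h R : ℝ) (n : ℕ) : ContDiff ℝ ∞ (process c h R n) := by
  unfold process
  exact ContDiff.sum fun j _ => contDiff_const.mul (contDiff_bump h R j)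

/-- `0 ≤ bump ≤ 1`. [folklore] -/
theorem bump_mem_Icc (h R : ℝ) (j : ℕ) (s : ℝ) : bump h R j s ∈ Icc (0 : ℝ) 1 :=
  ⟨cutoff_nonneg _ _, cutoff_le_one _ _⟩

/-- The plateau function of quarter `j` vanishes at distance `≥ h/2` from its midpoint, in
particular outside the open quarter `(jh, (j+1)h)`. [folklore] -/
theorem bump_eq_zero {h R : ℝ} (hh : 0 < h) (hR : 0 < R) {j : ℕ} {s : ℝ}
    (hs : h / 2 ≤ |s - ((j : ℝ) + 1 / 2) * h|) : bump h R j s = 0 := by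
  apply cutoff_eq_zero
  rw [abs_mul, abs_of_pos (by positivity : (0 : ℝ) < 2 * R / h)]
  have e : h / 2 * (2 * R / h) = R := by field_simp
  calc R = h / 2 * (2 * R / h) := e.symm
    _ ≤ |s - ((j : ℝ) + 1 / 2) * h| * (2 * R / h) := by gcongr

/-- The plateau function of quarter `j` equals `1` on the plateau
`|s - (j+1/2)h| ≤ h/2 - h/(2R)`. [folklore] -/
theorem bump_eq_one {h R : ℝ} (hh : 0 < h) (hR : 0 < R) {j : ℕ} {s : ℝ}
    (hs : |s - ((j : ℝ) + 1 / 2) * h| ≤ h / 2 - h / (2 * R)) : bump h R j s = 1 := by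
  apply cutoff_eq_one
  rw [abs_mul, abs_of_pos (by positivity : (0 : ℝ) < 2 * R / h)]
  have e : (h / 2 - h / (2 * R)) * (2 * R / h) = R - 1 := by field_simp
  calc |s - ((j : ℝ) + 1 / 2) * h| * (2 * R / h) ≤ (h / 2 - h / (2 * R)) * (2 * R / h) := by gcongr
    _ = R - 1 := e

/-- If the plateau function of quarter `j` does not vanish at `s`, then `s` lies in the open
quarter `(jh, (j+1)h)`. [folklore] -/
theorem mem_Ioo_of_bump_ne_zero {h R : ℝ} (hh : 0 < h) (hR : 0 < R) {j : ℕ} {s : ℝ}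
    (hs : bump h R j s ≠ 0) : s ∈ Ioo ((j : ℝ) * h) (((j : ℝ) + 1) * h) := by
  by_contra hcon
  apply hs (bump_eq_zero hh hR _)
  rw [mem_Ioo, not_and_or, not_lt, not_lt] at hcon
  rcases hcon with h1 | h1
  · rw [abs_sub_comm]
    refine le_trans ?_ (le_abs_self _)
    nlinarith
  · refine le_trans ?_ (le_abs_self _)
    nlinarith

/-- Two distinct plateau functions are never simultaneously nonzero. [folklore] -/
theorem bump_eq_zero_of_ne {h R : ℝ} (hh : 0 < h) (hR : 0 < R) {j j' : ℕ} (hne : j' ≠ j) {s : ℝ}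
    (hs : bump h R j s ≠ 0) : bump h R j' s = 0 := by
  by_contra hs'
  have h1 := mem_Ioo_of_bump_ne_zero hh hR hs
  have h2 := mem_Ioo_of_bump_ne_zero hh hR hs'
  -- both `j` and `j'` equal `⌊s/h⌋`
  have k1 : (j : ℝ) < s / h := by rw [lt_div_iff₀ hh]; exact h1.1
  have k2 : s / h < (j : ℝ) + 1 := by rw [div_lt_iff₀ hh]; exact h1.2
  have k3 : (j' : ℝ) < s / h := by rw [lt_div_iff₀ hh]; exact h2.1
  have k4 : s / h < (j' : ℝ) + 1 := by rw [div_lt_iff₀ hh]; exact h2.2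
  have k5 : (j : ℝ) < (j' : ℝ) + 1 := k1.trans k4
  have k6 : (j' : ℝ) < (j : ℝ) + 1 := k3.trans k2
  have k7 : j < j' + 1 := by exact_mod_cast k5
  have k8 : j' < j + 1 := by exact_mod_cast k6
  exact hne (by omega)

/-- **The processes take values in `[-1, 1]`** when `|cⱼ| ≤ 1` (at each point at most one
plateau function is nonzero). [cite: Ozanski2017NSIInternal, Thm. 10] -/
theorem abs_process_le_one {c : Fin 4 → ℝ} (hc : ∀ i, |c i| ≤ 1) {h R : ℝ} (hh : 0 < h)
    (hR : 0 < R) (n : ℕ) (s : ℝ) : |process c h R n s| ≤ 1 := by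
  unfold process
  by_cases hex : ∃ j ∈ Finset.range n, bump h R j s ≠ 0
  · obtain ⟨j, hj, hjs⟩ := hex
    rw [Finset.sum_eq_single_of_mem j hj fun j' _ hne => by
      rw [bump_eq_zero_of_ne hh hR hne hjs, mul_zero] ]
    rw [abs_mul]
    have hb := bump_mem_Icc h R j s
    calc |c ⟨j % 4, _⟩| * |bump h R j s| ≤ 1 * 1 := by
          refine mul_le_mul (hc _) ?_ (abs_nonneg _) zero_le_one
          rw [abs_of_nonneg hb.1]; exact hb.2
      _ = 1 := one_mul _
  · push Not at hex
    rw [Finset.sum_eq_zero fun j hj => by rw [hex j hj, mul_zero] ]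
    simp

/-- **On the plateau of quarter `j < n` the process equals the quarter value `c_{j mod 4}`**
(there the `j`-th plateau function is `1` and all others vanish). [cite: Ozanski2017NSIInternal, §4.3 p. 19] -/
theorem process_eq {c : Fin 4 → ℝ} {h R : ℝ} (hh : 0 < h) (hR : 0 < R) {n j : ℕ} (hj : j < n)
    {s : ℝ} (hs : |s - ((j : ℝ) + 1 / 2) * h| ≤ h / 2 - h / (2 * R)) :
    process c h R n s = c ⟨j % 4, Nat.mod_lt _ (by norm_num)⟩ := by
  have hone : bump h R j s = 1 := bump_eq_one hh hR hs
  unfold process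
  rw [Finset.sum_eq_single_of_mem j (Finset.mem_range.2 hj) fun j' _ hne => by
    rw [bump_eq_zero_of_ne hh hR hne (by rw [hone]; exact one_ne_zero), mul_zero] ]
  rw [hone, mul_one]

/-- The plateau `[jh + w, (j+1)h - w]`, `w = h/(2R)`, in midpoint form. [folklore] -/
theorem abs_sub_midpoint_le {h R : ℝ} {j : ℕ} {s : ℝ}
    (hs : s ∈ Icc ((j : ℝ) * h + h / (2 * R)) (((j : ℝ) + 1) * h - h / (2 * R))) :
    |s - ((j : ℝ) + 1 / 2) * h| ≤ h / 2 - h / (2 * R) := by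
  rw [abs_le]
  constructor <;> nlinarith [hs.1, hs.2]

/-- With `n = 0` quarters the process is identically zero. [folklore] -/
@[simp] theorem process_zero_right (c : Fin 4 → ℝ) (h R : ℝ) : process c h R 0 = 0 := by
  funext s
  simp [process]

/-! ### Integrals of functions vanishing on the plateaus -/

/-- **The smoothing error.** Let `h > 0`, `0 < w`, `2w ≤ h`, and let `f` be interval integrable
on `[0, nh]` with `|f| ≤ B` there and `f = 0` on every plateau `[jh + w, (j+1)h - w]`, `j < n`.
Then `|∫₀ᵗ f| ≤ n(2wB)` for all `t ∈ [0, nh]` (Ożański 2017, p. 19: the smoothed and the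
square-wave integrands agree off a set of measure `≤ n · 2w` on which both are bounded, "the
difference … is bounded by `6N/k`"). [cite: Ozanski2017NSIInternal, §4.3 p. 19] -/
theorem abs_integral_le_of_eqOn_plateau_zero {h w B : ℝ} (hh : 0 < h) (hw : 0 < w)
    (hw2 : 2 * w ≤ h) {n : ℕ} {f : ℝ → ℝ}
    (hf : IntervalIntegrable f volume 0 ((n : ℝ) * h))
    (hB : ∀ s ∈ Icc 0 ((n : ℝ) * h), |f s| ≤ B)
    (hzero : ∀ j < n, ∀ s ∈ Icc ((j : ℝ) * h + w) (((j : ℝ) + 1) * h - w), f s = 0)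
    {t : ℝ} (ht : t ∈ Icc 0 ((n : ℝ) * h)) :
    |∫ s in 0..t, f s| ≤ n * (2 * w * B) := by
  have hB0 : 0 ≤ B := by
    rcases n.eq_zero_or_pos with hn | hn
    · -- degenerate case: `t = 0`
      subst hn
      have : t = 0 := le_antisymm (by simpa using ht.2) ht.1
      exact (abs_nonneg (f 0)).trans (hB 0 ⟨le_rfl, by simp⟩)
    · exact (abs_nonneg (f 0)).trans (hB 0 ⟨le_rfl, by positivity⟩)
  have hnh : 0 ≤ (n : ℝ) * h := by positivity
  -- `|∫₀ᵗ f| ≤ ∫₀ᵗ |f| ≤ ∫₀^{nh} |f|`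
  have hfa : IntervalIntegrable (fun s => |f s|) volume 0 ((n : ℝ) * h) := hf.abs
  have step1 : |∫ s in 0..t, f s| ≤ ∫ s in 0..t, |f s| :=
    abs_integral_le_integral_abs ht.1
  have step2 : ∫ s in 0..t, |f s| ≤ ∫ s in 0..((n : ℝ) * h), |f s| :=
    integral_mono_interval le_rfl ht.1 ht.2
      (Filter.Eventually.of_forall fun s => abs_nonneg (f s)) hfa
  -- sum over the quarters
  have hint : ∀ j < n, IntervalIntegrable (fun s => |f s|) volume ((j : ℝ) * h)
      (((j : ℝ) + 1) * h) := fun j hj => by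
    refine hfa.mono_set ?_
    rw [uIcc_of_le hnh, uIcc_of_le (by nlinarith)]
    refine Icc_subset_Icc (by positivity) ?_
    have : (j : ℝ) + 1 ≤ n := by exact_mod_cast hj
    nlinarith
  have hsum := sum_integral_adjacent_intervals (f := fun s => |f s|) (μ := volume)
    (a := fun j : ℕ => (j : ℝ) * h) (n := n) fun j hj => by
      push_cast
      exact hint j hj
  simp only [Nat.cast_zero, zero_mul] at hsum
  -- each quarter contributes at most `2wB`
  have hquarter : ∀ j ∈ Finset.range n,
      ∫ s in ((j : ℝ) * h)..(((j + 1 : ℕ) : ℝ) * h), |f s| ≤ 2 * w * B := by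
    intro j hj
    rw [Finset.mem_range] at hj
    push_cast
    set a : ℝ := (j : ℝ) * h with ha
    set b : ℝ := ((j : ℝ) + 1) * h with hb
    have hab : a + w ≤ b - w := by rw [ha, hb]; nlinarith
    have hjn : b ≤ (n : ℝ) * h := by
      have : (j : ℝ) + 1 ≤ n := by exact_mod_cast hj
      rw [hb]; nlinarith
    have ha0 : 0 ≤ a := by positivity
    have hI : IntervalIntegrable (fun s => |f s|) volume a b := hint j hj
    have hIab : ∀ {u v : ℝ}, u ∈ Icc a b → v ∈ Icc a b →
        IntervalIntegrable (fun s => |f s|) volume u v := fun hu hv =>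
      hI.mono_set (by rw [uIcc_of_le (by linarith : a ≤ b)]; exact uIcc_subset_Icc hu hv)
    have m1 : a + w ∈ Icc a b := ⟨by linarith, by linarith⟩
    have m2 : b - w ∈ Icc a b := ⟨by linarith, by linarith⟩
    have ma : a ∈ Icc a b := ⟨le_rfl, by linarith⟩
    have mb : b ∈ Icc a b := ⟨by linarith, le_rfl⟩
    rw [← integral_add_adjacent_intervals (b := a + w) (hIab ma m1) (hIab m1 mb),
      ← integral_add_adjacent_intervals (b := b - w) (hIab m1 m2) (hIab m2 mb)]
    -- the middle integral vanishes
    have hmid : ∫ s in (a + w)..(b - w), |f s| = 0 := by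
      rw [integral_congr (g := fun _ => (0 : ℝ)) fun s hs => ?_, intervalIntegral.integral_zero]
      rw [uIcc_of_le hab] at hs
      simp only [hzero j hj s (by rw [ha, hb] at hs; exact hs), abs_zero]
    -- the two margins
    have hbd : ∀ {u v : ℝ}, u ∈ Icc a b → v ∈ Icc a b → u ≤ v →
        ∫ s in u..v, |f s| ≤ B * (v - u) := fun {u v} hu hv huv => by
      have hle : ∀ s ∈ Ι u v, ‖|f s|‖ ≤ B := fun s hs => by
        rw [uIoc_of_le huv] at hs
        rw [Real.norm_eq_abs, abs_abs]
        exact hB s ⟨ha0.trans (hu.1.trans hs.1.le), hs.2.trans (hv.2.trans hjn)⟩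
      have := norm_integral_le_of_norm_le_const hle
      rw [Real.norm_eq_abs, abs_of_nonneg (sub_nonneg.2 huv)] at this
      exact (le_abs_self _).trans this
    have e1 := hbd ma m1 (by linarith)
    have e2 := hbd m2 mb (by linarith)
    rw [hmid, zero_add]
    calc (∫ s in a..(a + w), |f s|) + ∫ s in (b - w)..b, |f s| ≤ B * (a + w - a) + B * (b - (b - w)) :=
          add_le_add e1 e2
      _ = 2 * w * B := by ring
  calc |∫ s in 0..t, f s| ≤ ∫ s in 0..((n : ℝ) * h), |f s| := step1.trans step2
    _ = ∑ j ∈ Finset.range n, ∫ s in ((j : ℝ) * h)..(((j + 1 : ℕ) : ℝ) * h), |f s| := hsum.symm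
    _ ≤ ∑ _j ∈ Finset.range n, 2 * w * B := Finset.sum_le_sum hquarter
    _ = n * (2 * w * B) := by rw [Finset.sum_const, Finset.card_range, nsmul_eq_mul]

/-! ### Auxiliary continuity facts -/

/-- A function with a uniform modulus of continuity on a set is continuous there. [folklore] -/
theorem continuousOn_of_modulus {φ : ℝ → ℝ} {S : Set ℝ}
    (h : ∀ ε > 0, ∃ δ > 0, ∀ s ∈ S, ∀ s' ∈ S, |s - s'| < δ → |φ s - φ s'| ≤ ε) :
    ContinuousOn φ S := by
  rw [Metric.continuousOn_iff]
  intro s hs ε hε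
  obtain ⟨δ, hδ, hmod⟩ := h (ε / 2) (half_pos hε)
  refine ⟨δ, hδ, fun s' hs' hd => ?_⟩
  rw [Real.dist_eq] at hd ⊢
  linarith [hmod s' hs' s hs hd]

/-- Slices `s ↦ F(s, b)` of a jointly continuous `F` on `[0,T] × [-1,1]` are continuous on
`[0,T]`, and so are the compositions `s ↦ F(s, a(s))` with a continuous `a` valued in `[-1,1]`. [folklore] -/
theorem continuousOn_comp_of_mem {T : ℝ} {F : ℝ → ℝ → ℝ}
    (hF : ContinuousOn (uncurry F) (Icc 0 T ×ˢ Icc (-1) 1)) {a : ℝ → ℝ} (ha : Continuous a)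
    (hmem : ∀ s, a s ∈ Icc (-1 : ℝ) 1) : ContinuousOn (fun s => F s (a s)) (Icc 0 T) := by
  have : (fun s => F s (a s)) = uncurry F ∘ fun s => (s, a s) := rfl
  rw [this]
  exact hF.comp (continuousOn_id.prodMk ha.continuousOn) fun s hs => ⟨hs, hmem s⟩

/-! ### The approximation lemma -/

/-- The averaging estimate in the normalisation `h = T/(4k)`: for `|cⱼ| ≤ 1`, `φ` continuous on
`[0,T]` with `|φ| ≤ N` and `|φ(s) - φ(s')| ≤ ε` for `|s - s'| ≤ T/k`,
`|∫₀ᵗ wave c h · φ - ((Σcⱼ)/4) ∫₀ᵗ φ| ≤ 2εT + 2N T/k` (`abs_integral_wave_mul_sub_le`).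
[cite: Ozanski2017NSIInternal, §4.3 (4.30)–(4.31)] -/
theorem abs_integral_wave_mul_sub_le' {T : ℝ} (hT : 0 < T) {k : ℕ} (hk : 0 < k) {c : Fin 4 → ℝ}
    (hc : ∀ j, |c j| ≤ 1) {φ : ℝ → ℝ} (hφ : ContinuousOn φ (Icc 0 T)) {N ε : ℝ}
    (hN : ∀ s ∈ Icc 0 T, |φ s| ≤ N)
    (hε : ∀ s ∈ Icc 0 T, ∀ s' ∈ Icc 0 T, |s - s'| ≤ T / k → |φ s - φ s'| ≤ ε)
    {t : ℝ} (ht : t ∈ Icc 0 T) :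
    |(∫ s in 0..t, wave c (T / (4 * k)) s * φ s) - (∑ j, c j) / 4 * ∫ s in 0..t, φ s| ≤
      2 * ε * T + 2 * N * (T / k) := by
  have hk' : (0 : ℝ) < k := by exact_mod_cast hk
  have e1 : ((4 * k : ℕ) : ℝ) * (T / (4 * k)) = T := by push_cast; field_simp
  have e2 : 4 * (T / (4 * k)) = T / k := by field_simp
  have hh : 0 < T / (4 * k) := by positivity
  have := abs_integral_wave_mul_sub_le hh hk hc (e1.symm ▸ hφ) (N := N) (ε := ε)
    (e1.symm ▸ hN) (fun s hs s' hs' hss' => hε s (e1 ▸ hs) s' (e1 ▸ hs') (e2 ▸ hss'))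
    (t := t) (e1.symm ▸ ht)
  rwa [e1, e2] at this

/-- **Approximation lemma** (the structure of Ożański's proof of Thm. 10, pp. 18–19). Let
`k ≥ 1`, `h = T/(4k)` and let `A` be integrable on `[0,T]` with `|A| ≤ B`. Suppose that on
every plateau `[jh + w, (j+1)h - w]`, `w = h/(2(k+1))`, `j < 4k`, `A` agrees with a finite sum
`Σ_r wave c_r h · φ_r` of square waves times continuous functions (`|c_{r,j}| ≤ 1`,
`|φ_r| ≤ N`, `|φ_r(s) - φ_r(s')| ≤ ε` for `|s - s'| ≤ T/k`). Then for all `t ∈ [0,T]`,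
`|∫₀ᵗ A - Σ_r ((Σⱼ c_{r,j})/4) ∫₀ᵗ φ_r| ≤ (B + mN) T/(k+1) + m (2εT + 2N T/k)`
(smoothing error `abs_integral_le_of_eqOn_plateau_zero` plus `m` averaging estimates).
[cite: Ozanski2017NSIInternal, §4.3 pp. 18–19] -/
theorem abs_integral_sub_sum_le {T : ℝ} (hT : 0 < T) {k : ℕ} (hk : 0 < k) {m : ℕ}
    (c : Fin m → Fin 4 → ℝ) (hc : ∀ r j, |c r j| ≤ 1) (φ : Fin m → ℝ → ℝ)
    (hφ : ∀ r, ContinuousOn (φ r) (Icc 0 T)) {N ε B : ℝ} (hN : ∀ r, ∀ s ∈ Icc 0 T, |φ r s| ≤ N)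
    (hε : ∀ r, ∀ s ∈ Icc 0 T, ∀ s' ∈ Icc 0 T, |s - s'| ≤ T / k → |φ r s - φ r s'| ≤ ε)
    {A : ℝ → ℝ} (hA : IntervalIntegrable A volume 0 T) (hB : ∀ s ∈ Icc 0 T, |A s| ≤ B)
    (hAg : ∀ j < 4 * k, ∀ s ∈ Icc ((j : ℝ) * (T / (4 * k)) + T / (4 * k) / (2 * (k + 1)))
        (((j : ℝ) + 1) * (T / (4 * k)) - T / (4 * k) / (2 * (k + 1))),
        A s = ∑ r, wave (c r) (T / (4 * k)) s * φ r s)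
    {t : ℝ} (ht : t ∈ Icc 0 T) :
    |(∫ s in 0..t, A s) - ∑ r, (∑ j, c r j) / 4 * ∫ s in 0..t, φ r s| ≤
      (B + m * N) * (T / (k + 1)) + m * (2 * ε * T + 2 * N * (T / k)) := by
  have hk' : (0 : ℝ) < k := by exact_mod_cast hk
  set h : ℝ := T / (4 * k) with hh_def
  have hh : 0 < h := by positivity
  have hnh : ((4 * k : ℕ) : ℝ) * h = T := by rw [hh_def]; push_cast; field_simp
  set w : ℝ := h / (2 * (k + 1)) with hw_def
  have hw : 0 < w := by positivity
  have hw2 : 2 * w ≤ h := by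
    rw [hw_def, mul_div_assoc', div_le_iff₀ (by positivity)]
    nlinarith
  have h0T : (0 : ℝ) ∈ Icc 0 T := ⟨le_rfl, hT.le⟩
  have hN0 : 0 ≤ N ∨ m = 0 := by
    rcases m.eq_zero_or_pos with hm | hm
    · exact Or.inr hm
    · exact Or.inl ((abs_nonneg _).trans (hN ⟨0, hm⟩ 0 h0T))
  -- the model function `g = Σ_r wave c_r h · φ_r`
  set g : ℝ → ℝ := fun s => ∑ r, wave (c r) h s * φ r s with hg_def
  have hIr : ∀ r, ∀ {u v : ℝ}, u ∈ Icc 0 T → v ∈ Icc 0 T →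
      IntervalIntegrable (fun s => wave (c r) h s * φ r s) volume u v := fun r u v hu hv =>
    intervalIntegrable_wave_mul_of_mem hh (c r) (n := 4 * k) (hnh.symm ▸ hφ r) (hnh.symm ▸ hu)
      (hnh.symm ▸ hv)
  have hIg : ∀ {u v : ℝ}, u ∈ Icc 0 T → v ∈ Icc 0 T → IntervalIntegrable g volume u v :=
    fun hu hv => by
    have := IntervalIntegrable.sum (μ := volume) Finset.univ fun r _ => hIr r hu hv
    refine this.congr fun s _ => ?_
    simp [hg_def, Finset.sum_apply]
  have hgN : ∀ s ∈ Icc 0 T, |g s| ≤ m * N := fun s hs => by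
    calc |g s| ≤ ∑ r, |wave (c r) h s * φ r s| := Finset.abs_sum_le_sum_abs _ _
      _ ≤ ∑ _r : Fin m, N := Finset.sum_le_sum fun r _ => by
          rw [abs_mul]
          calc |wave (c r) h s| * |φ r s| ≤ 1 * N :=
                mul_le_mul (abs_wave_le (hc r) h s) (hN r s hs) (abs_nonneg _) zero_le_one
            _ = N := one_mul N
      _ = m * N := by simp
  -- (1) the smoothing error `∫₀ᵗ (A - g)`
  have hB0 : 0 ≤ B := (abs_nonneg _).trans (hB 0 h0T)
  have herr : |∫ s in 0..t, (A s - g s)| ≤ (4 * k : ℕ) * (2 * w * (B + m * N)) := by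
    refine abs_integral_le_of_eqOn_plateau_zero hh hw hw2 (n := 4 * k) (f := fun s => A s - g s)
      ?_ ?_ ?_ (hnh.symm ▸ ht)
    · rw [hnh]; exact hA.sub (hIg h0T ⟨hT.le, le_rfl⟩)
    · intro s hs
      rw [hnh] at hs
      calc |A s - g s| ≤ |A s| + |g s| := abs_sub _ _
        _ ≤ B + m * N := add_le_add (hB s hs) (hgN s hs)
    · intro j hj s hs
      rw [hAg j hj s (by rw [hw_def, hh_def] at hs; exact hs)]
      simp [hg_def]
  have herr' : ((4 * k : ℕ) : ℝ) * (2 * w * (B + m * N)) = (B + m * N) * (T / (k + 1)) := by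
    rw [hw_def, ← hnh]
    push_cast
    field_simp
  -- (2) the averaging errors
  have havg : ∀ r, |(∫ s in 0..t, wave (c r) h s * φ r s) - (∑ j, c r j) / 4 * ∫ s in 0..t, φ r s|
      ≤ 2 * ε * T + 2 * N * (T / k) := fun r =>
    abs_integral_wave_mul_sub_le' hT hk (hc r) (hφ r) (hN r) (hε r) ht
  -- combine
  have hsplit : (∫ s in 0..t, A s) = (∫ s in 0..t, (A s - g s)) + ∫ s in 0..t, g s := by
    rw [intervalIntegral.integral_sub (hA.mono_set (by
        rw [uIcc_of_le hT.le, uIcc_of_le ht.1]; exact Icc_subset_Icc le_rfl ht.2))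
      (hIg h0T ht)]
    ring
  have hgsum : ∫ s in 0..t, g s = ∑ r, ∫ s in 0..t, wave (c r) h s * φ r s := by
    rw [hg_def, intervalIntegral.integral_finsetSum]
    exact fun r _ => hIr r h0T ht
  rw [hsplit, hgsum, add_sub_assoc, ← Finset.sum_sub_distrib]
  calc |(∫ s in 0..t, (A s - g s)) +
          ∑ r, ((∫ s in 0..t, wave (c r) h s * φ r s) - (∑ j, c r j) / 4 * ∫ s in 0..t, φ r s)|
      ≤ |∫ s in 0..t, (A s - g s)| +
          |∑ r, ((∫ s in 0..t, wave (c r) h s * φ r s) - (∑ j, c r j) / 4 * ∫ s in 0..t, φ r s)| :=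
        abs_add_le _ _
    _ ≤ (B + m * N) * (T / (k + 1)) + ∑ r, |(∫ s in 0..t, wave (c r) h s * φ r s) -
          (∑ j, c r j) / 4 * ∫ s in 0..t, φ r s| :=
        add_le_add (herr.trans_eq herr') (Finset.abs_sum_le_sum_abs _ _)
    _ ≤ (B + m * N) * (T / (k + 1)) + ∑ _r : Fin m, (2 * ε * T + 2 * N * (T / k)) := by
        gcongr with r _
        exact havg r
    _ = (B + m * N) * (T / (k + 1)) + m * (2 * ε * T + 2 * N * (T / k)) := by
        rw [Finset.sum_const, Finset.card_univ, Fintype.card_fin, nsmul_eq_mul]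

end Scheffer

end Literature.Barriers.NavierStokesRegularity
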